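import Summits.AtomisticToContinuum.FouriersLaw.Theorems.PhononMeanFreePathCoherentDephasingHeadBound
import Summits.AtomisticToContinuum.FouriersLaw.Theorems.BondHeatUncertaintyLightConeBondHeatGibbsByParts
import Summits.AtomisticToContinuum.FouriersLaw.Theorems.PhononMeanFreePathIncoherentChannelLightConeReduction

/-!
# Strict absorption, sub-goal K5: an `N`-uniform variance floor for the local curvature

Registered stub `sa_varianceFloor` of line `Sketch` of crux `PhononMeanFreePath.CoherentDephasing`
(stmt-AtomisticToContinuum-11810). For the `(N+1)`-site pinned anharmonic chain `pinnedChain ω₂ lam β γ` with Gibbs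
measure `μ_N = Z⁻¹ e^{-H/T} dq dp` and the local curvature `Φ = ∂²_{q_0}H = ω₂ + 3 lam q_0² + 1 + 3β(q_1 - q_0)²`:
`Var_{μ_N}(Φ) ≥ v₀ > 0` with `v₀` independent of `N ≥ 2`.

Proof (Cramér–Rao twice). With `W = ∂_{q_0}H = ω₂q_0 + lam q_0³ - ((q_1-q_0) + β(q_1-q_0)³)` and
`ℓ = lam q_0 - β(q_1 - q_0)` (`∂_{q_0}Φ = 6ℓ`, `∂_{q_0}ℓ = lam + β`), Gibbs integration by parts in `q_0`
(`∫ F W dμ = T ∫ ∂_{q_0}F dμ`, `varFloor_ibp`, from the tree's `integral_mul_eq_neg_of_hasLineDerivAt_of_integrable`)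
gives `∫ ℓ W dμ = T(lam+β)` and `∫ Φ ℓ W dμ = 6T ∫ ℓ² dμ + T(lam+β) ∫ Φ dμ`, so `∫ (Φ - ⟨Φ⟩) ℓ W dμ = 6T ∫ ℓ² dμ`.
Cauchy–Schwarz (`PhononMeanFreePath.lightCone_integral_mul_sq_le`) twice: `Var(Φ) ∫ ℓ²W² ≥ 36 T² (∫ ℓ²)²` and
`∫ ℓ² ∫ W² ≥ T²(lam+β)²`; the moments `∫ W²`, `∫ ℓ²W²` are bounded uniformly in `N` (domination by
`(1 + q_0² + q_1²)⁶` and the `N`-uniform position moments `HeadBound.gibbs_position_moment_le`).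
-/

noncomputable section

open MeasureTheory ProbabilityTheory Filter Topology Set
open scoped NNReal ENNReal

namespace Summit.AtomisticToContinuum.FouriersLaw.Theorems.CoherentDephasing.StrictAbsorption

open Literature.MathematicalPhysics.KineticTheory.HeatConduction
open Literature.MathematicalPhysics.KineticTheory Literature.Probability.Process OscillatorChain
open Summit.AtomisticToContinuum.FouriersLaw.Theorems.CoherentDephasing.HeadBound
open Summit.AtomisticToContinuum.FouriersLaw.Theorems.PhononMeanFreePath (lightCone_integral_mul_sq_le)

/-! ### Elementary inequalities -/

/-- `(1 + u + v)⁶ ≤ 3⁵ (1 + u⁶ + v⁶)` for `u, v ≥ 0` (power mean). [folklore] -/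
theorem varFloor_one_add_add_pow_six_le {u v : ℝ} (hu : 0 ≤ u) (hv : 0 ≤ v) :
    (1 + u + v) ^ 6 ≤ 243 * (1 + u ^ 6 + v ^ 6) := by
  have h := pow_sum_le_card_mul_sum_pow (s := (Finset.univ : Finset (Fin 3))) (f := ![(1 : ℝ), u, v])
    (fun i _ => by fin_cases i <;> simp [hu, hv]) 5
  simp only [Fin.sum_univ_three, Finset.card_univ, Fintype.card_fin, Matrix.cons_val_zero, Matrix.cons_val_one,
    Matrix.cons_val_two, Matrix.head_cons, Matrix.tail_cons] at h
  norm_num at h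
  linarith

/-- Pointwise bounds for `ℓ = lam a - β(c-a)`, `W = ω₂ a + lam a³ - ((c-a) + β(c-a)³)` and
`Φ = ω₂ + 3 lam a² + 1 + 3β(c-a)²` in terms of `X = 1 + a² + c² ≥ 1`. [folklore] -/
theorem varFloor_poly_bounds {ω₂ lam β : ℝ} (hω : 0 ≤ ω₂) (hl : 0 ≤ lam) (hβ : 0 ≤ β) (a c : ℝ) :
    1 ≤ 1 + a ^ 2 + c ^ 2 ∧ |lam * a - β * (c - a)| ≤ (lam + 2 * β) * (1 + a ^ 2 + c ^ 2) ∧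
      |ω₂ * a + lam * a ^ 3 - ((c - a) + β * (c - a) ^ 3)| ≤ (ω₂ + lam + 2 + 4 * β) * (1 + a ^ 2 + c ^ 2) ^ 2 ∧
      0 ≤ ω₂ + 3 * lam * a ^ 2 + 1 + 3 * β * (c - a) ^ 2 ∧
      ω₂ + 3 * lam * a ^ 2 + 1 + 3 * β * (c - a) ^ 2 ≤ (ω₂ + 1 + 3 * lam + 6 * β) * (1 + a ^ 2 + c ^ 2) := by
  set X := 1 + a ^ 2 + c ^ 2 with hX
  have ha : |a| ≤ X :=
    abs_le.mpr ⟨by nlinarith [sq_nonneg (a + 1), sq_nonneg c], by nlinarith [sq_nonneg (a - 1), sq_nonneg c]⟩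
  have hc : |c| ≤ X :=
    abs_le.mpr ⟨by nlinarith [sq_nonneg (c + 1), sq_nonneg a], by nlinarith [sq_nonneg (c - 1), sq_nonneg a]⟩
  have ha2 : a ^ 2 ≤ X := by nlinarith [sq_nonneg c]
  have hr : |c - a| ≤ 2 * X := (abs_sub _ _).trans (by linarith)
  have hr2 : (c - a) ^ 2 ≤ 2 * X := by nlinarith [sq_nonneg (a + c)]
  have h1 : 1 ≤ X := by nlinarith [sq_nonneg a, sq_nonneg c]
  have hX0 : 0 ≤ X := by linarith
  have hXX : X ≤ X ^ 2 := by nlinarith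
  refine ⟨h1, ?_, ?_, by positivity, ?_⟩
  · calc |lam * a - β * (c - a)| ≤ |lam * a| + |β * (c - a)| := abs_sub _ _
      _ = lam * |a| + β * |c - a| := by rw [abs_mul, abs_mul, abs_of_nonneg hl, abs_of_nonneg hβ]
      _ ≤ lam * X + β * (2 * X) := add_le_add (mul_le_mul_of_nonneg_left ha hl) (mul_le_mul_of_nonneg_left hr hβ)
      _ = (lam + 2 * β) * X := by ring
  · have h3 : |a ^ 3| ≤ X ^ 2 := by
      rw [show a ^ 3 = a * a ^ 2 by ring, abs_mul, abs_of_nonneg (sq_nonneg a), sq X]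
      exact mul_le_mul ha ha2 (sq_nonneg a) hX0
    have h4 : |(c - a) ^ 3| ≤ 4 * X ^ 2 := by
      rw [show (c - a) ^ 3 = (c - a) * (c - a) ^ 2 by ring, abs_mul, abs_of_nonneg (sq_nonneg (c - a)),
        show 4 * X ^ 2 = (2 * X) * (2 * X) by ring]
      exact mul_le_mul hr hr2 (sq_nonneg _) (by linarith)
    calc |ω₂ * a + lam * a ^ 3 - ((c - a) + β * (c - a) ^ 3)|
        ≤ |ω₂ * a + lam * a ^ 3| + |(c - a) + β * (c - a) ^ 3| := abs_sub _ _
      _ ≤ (|ω₂ * a| + |lam * a ^ 3|) + (|c - a| + |β * (c - a) ^ 3|) := add_le_add (abs_add_le _ _) (abs_add_le _ _)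
      _ = ω₂ * |a| + lam * |a ^ 3| + (|c - a| + β * |(c - a) ^ 3|) := by
          rw [abs_mul, abs_mul, abs_mul, abs_of_nonneg hω, abs_of_nonneg hl, abs_of_nonneg hβ]
      _ ≤ ω₂ * X + lam * X ^ 2 + (2 * X + β * (4 * X ^ 2)) := by gcongr
      _ ≤ (ω₂ + lam + 2 + 4 * β) * X ^ 2 := by nlinarith [mul_le_mul_of_nonneg_left hXX hω]
  · calc ω₂ + 3 * lam * a ^ 2 + 1 + 3 * β * (c - a) ^ 2 ≤ ω₂ + 3 * lam * X + 1 + 3 * β * (2 * X) := by gcongr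
      _ ≤ (ω₂ + 1 + 3 * lam + 6 * β) * X := by nlinarith [mul_le_mul_of_nonneg_left h1 hω]

/-! ### Calculus at the first site and Gibbs integration by parts in `q_0` -/

/-- `∂_{q_0} H = U'(q_0) - V'(q_1 - q_0) = ω₂ q_0 + lam q_0³ - ((q_1 - q_0) + β (q_1 - q_0)³)` on `n ≥ 2` sites. [folklore] -/
theorem varFloor_partialQ_zero (ω₂ lam β γ : ℝ) {n : ℕ} (hn : 2 ≤ n) {i0 i1 : Fin n} (h0 : i0.val = 0)
    (h1 : i1.val = 1) (x : PhaseSpace n) :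
    partialQ i0 ((pinnedChain ω₂ lam β γ).hamiltonian n) x =
      ω₂ * x.1 i0 + lam * x.1 i0 ^ 3 - ((x.1 i1 - x.1 i0) + β * (x.1 i1 - x.1 i0) ^ 3) := by
  -- adapted from `contact_partialQ_hamiltonian_zero` (…ConductanceLowerBoundContactCertificateAlgebra)
  have hU : Differentiable ℝ (pinnedChain ω₂ lam β γ).U :=
    (pinnedChain_contDiff_U ω₂ lam β γ (n := 1)).differentiable one_ne_zero
  have hV : Differentiable ℝ (pinnedChain ω₂ lam β γ).V :=
    (pinnedChain_contDiff_V ω₂ lam β γ (n := 1)).differentiable one_ne_zero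
  rw [(pinnedChain ω₂ lam β γ).partialQ_hamiltonian_eq_dPotential hU hV, OscillatorChain.dPotential_eq_closed]
  have h1' : ¬ (0 < i0.val) := by omega
  have h2 : i0.val + 1 < n := by omega
  rw [dif_neg h1', dif_pos h2, add_zero, pinnedChain_deriv_U, pinnedChain_deriv_V]
  have h3 : (⟨i0.val + 1, h2⟩ : Fin n) = i1 := Fin.ext (by simp [h0, h1])
  rw [h3]

/-- Line derivative along `(e_{i0}, 0)` of a function of `(q_{i0}, q_{i1})`, `i1 ≠ i0`, from the one-variable derivative
in `q_{i0}`. [folklore] -/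
theorem varFloor_hasLineDerivAt_of_hasDerivAt {n : ℕ} {i0 i1 : Fin n} (h01 : i1 ≠ i0) (φ : ℝ → ℝ → ℝ)
    (x : PhaseSpace n) {D : ℝ} (h : HasDerivAt (fun t : ℝ => φ (x.1 i0 + t) (x.1 i1)) D 0) :
    HasLineDerivAt ℝ (fun z : PhaseSpace n => φ (z.1 i0) (z.1 i1)) D x ((Pi.single i0 1, 0) : PhaseSpace n) := by
  unfold HasLineDerivAt
  have e : (fun t : ℝ => (fun z : PhaseSpace n => φ (z.1 i0) (z.1 i1)) (x + t • ((Pi.single i0 1, 0) : PhaseSpace n))) =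
      fun t => φ (x.1 i0 + t) (x.1 i1) := by
    funext t
    simp [h01]
  rw [e]
  exact h

section Gibbs

variable {ω₂ lam β : ℝ} (hω : 0 < ω₂) (hl : 0 ≤ lam) (hβ : 0 ≤ β) (γ : ℝ) {T : ℝ} (hT : 0 < T)
include hω hl hβ hT

/-- `g ∈ L¹(μ_T)` gives `g e^{-H/T} ∈ L¹(dq dp)`. [folklore] -/
theorem varFloor_integrable_mul_gibbsDensity {n : ℕ} {g : PhaseSpace n → ℝ}
    (hg : Integrable g ((pinnedChain ω₂ lam β γ).gibbsMeasure n T)) :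
    Integrable fun x => g x * (pinnedChain ω₂ lam β γ).gibbsDensity n T x := by
  have hρ : Integrable (fun x => Real.exp (-(pinnedChain ω₂ lam β γ).hamiltonian n x / T)) :=
    pinnedChain_integrable_gibbsDensity hω hl hβ γ n hT
  rw [OscillatorChain.gibbsMeasure_eq, integrable_tilted_iff hρ] at hg
  refine hg.congr (Eventually.of_forall fun x => ?_)
  simp only [smul_eq_mul, OscillatorChain.exp_neg_hamiltonian_div]
  ring

/-- **Gibbs integration by parts in `q_i`** (normalised form): `∫ F ∂_{q_i}H dμ_T = T ∫ ∂_{q_i}F dμ_T` whenever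
`F, ∂_{q_i}F, F ∂_{q_i}H ∈ L¹(μ_T)` (`∂_{q_i} e^{-H/T} = -(∂_{q_i}H/T) e^{-H/T}`). [folklore] -/
theorem varFloor_ibp {n : ℕ} (i : Fin n) {F F' : PhaseSpace n → ℝ}
    (hFd : ∀ x, HasLineDerivAt ℝ F (F' x) x ((Pi.single i 1, 0) : PhaseSpace n))
    (hF' : Integrable F' ((pinnedChain ω₂ lam β γ).gibbsMeasure n T))
    (hFW : Integrable (fun x => F x * partialQ i ((pinnedChain ω₂ lam β γ).hamiltonian n) x)
      ((pinnedChain ω₂ lam β γ).gibbsMeasure n T))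
    (hF : Integrable F ((pinnedChain ω₂ lam β γ).gibbsMeasure n T)) :
    ∫ x, F x * partialQ i ((pinnedChain ω₂ lam β γ).hamiltonian n) x ∂((pinnedChain ω₂ lam β γ).gibbsMeasure n T) =
      T * ∫ x, F' x ∂((pinnedChain ω₂ lam β γ).gibbsMeasure n T) := by
  set P := pinnedChain ω₂ lam β γ with hP
  have hHd : Differentiable ℝ (P.hamiltonian n) :=
    (pinnedChain_contDiff_hamiltonian ω₂ lam β γ n (n := 1)).differentiable one_ne_zero
  have hFg' : Integrable fun x => F x * (-(partialQ i (P.hamiltonian n) x / T) * P.gibbsDensity n T x) := by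
    refine ((varFloor_integrable_mul_gibbsDensity hω hl hβ γ hT hFW).const_mul (-T⁻¹)).congr
      (Eventually.of_forall fun x => ?_)
    simp only
    ring
  have e := SubdiffusiveBondHeat.integral_mul_eq_neg_of_hasLineDerivAt_of_integrable (F := F) (F' := F')
    (g := P.gibbsDensity n T) (g' := fun x => -(partialQ i (P.hamiltonian n) x / T) * P.gibbsDensity n T x)
    (v := ((Pi.single i 1, 0) : PhaseSpace n)) (varFloor_integrable_mul_gibbsDensity hω hl hβ γ hT hF') hFg'
    (varFloor_integrable_mul_gibbsDensity hω hl hβ γ hT hF) hFd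
    (fun x => P.hasLineDerivAt_gibbsDensity (P.hasLineDerivAt_hamiltonian_unitQ hHd x i))
  have lhs : ∫ x, F x * (-(partialQ i (P.hamiltonian n) x / T) * P.gibbsDensity n T x) =
      -T⁻¹ * ∫ x, F x * partialQ i (P.hamiltonian n) x * P.gibbsDensity n T x := by
    rw [← integral_const_mul]
    exact integral_congr_ae (Eventually.of_forall fun x => by ring)
  rw [lhs] at e
  have e2 : T⁻¹ * ∫ x, F x * partialQ i (P.hamiltonian n) x * P.gibbsDensity n T x =
      ∫ x, F' x * P.gibbsDensity n T x := by linarith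
  have e3 : ∫ x, F x * partialQ i (P.hamiltonian n) x * P.gibbsDensity n T x =
      T * ∫ x, F' x * P.gibbsDensity n T x := by
    rw [← e2, ← mul_assoc, mul_inv_cancel₀ hT.ne', one_mul]
  rw [P.integral_gibbsMeasure (fun x => F x * partialQ i (P.hamiltonian n) x), P.integral_gibbsMeasure F', e3]
  ring

/-- Domination by `K (1 + q_{i0}² + q_{i1}²)⁶` together with the moment bound `∫ q_i¹² dμ_T ≤ C`: `f ∈ L¹(μ_T)` and
`∫ |f| dμ_T ≤ 243 K (1 + 2C)`. [folklore] -/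
theorem varFloor_dominated {n : ℕ} (i0 i1 : Fin n) {f : PhaseSpace n → ℝ} (hf : Continuous f) {K : ℝ}
    (hK : 0 ≤ K) (hle : ∀ z, |f z| ≤ K * (1 + z.1 i0 ^ 2 + z.1 i1 ^ 2) ^ 6) {C : ℝ}
    (hC : ∀ i : Fin n, ∫ z, z.1 i ^ 12 ∂((pinnedChain ω₂ lam β γ).gibbsMeasure n T) ≤ C) :
    Integrable f ((pinnedChain ω₂ lam β γ).gibbsMeasure n T) ∧
      ∫ z, |f z| ∂((pinnedChain ω₂ lam β γ).gibbsMeasure n T) ≤ K * (243 * (1 + 2 * C)) := by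
  haveI := pinnedChain_isProbabilityMeasure_gibbsMeasure hω hl hβ γ n hT
  set μ := (pinnedChain ω₂ lam β γ).gibbsMeasure n T with hμ
  have hI : ∀ i : Fin n, Integrable (fun z : PhaseSpace n => z.1 i ^ 12) μ :=
    fun i => integrable_position_pow hω hl hβ γ hT 12 n i
  have hdom : Integrable (fun z : PhaseSpace n => K * (243 * (1 + z.1 i0 ^ 12 + z.1 i1 ^ 12))) μ :=
    ((((integrable_const 1).fun_add (hI i0)).fun_add (hI i1)).const_mul 243).const_mul K
  have hpt : ∀ z : PhaseSpace n, |f z| ≤ K * (243 * (1 + z.1 i0 ^ 12 + z.1 i1 ^ 12)) := fun z => by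
    refine (hle z).trans (mul_le_mul_of_nonneg_left ?_ hK)
    have h := varFloor_one_add_add_pow_six_le (sq_nonneg (z.1 i0)) (sq_nonneg (z.1 i1))
    calc (1 + z.1 i0 ^ 2 + z.1 i1 ^ 2) ^ 6 ≤ 243 * (1 + (z.1 i0 ^ 2) ^ 6 + (z.1 i1 ^ 2) ^ 6) := h
      _ = 243 * (1 + z.1 i0 ^ 12 + z.1 i1 ^ 12) := by ring
  have hint : Integrable f μ :=
    hdom.mono' hf.aestronglyMeasurable (Eventually.of_forall fun z => by rw [Real.norm_eq_abs]; exact hpt z)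
  refine ⟨hint, ?_⟩
  calc ∫ z, |f z| ∂μ ≤ ∫ z, K * (243 * (1 + z.1 i0 ^ 12 + z.1 i1 ^ 12)) ∂μ := integral_mono hint.abs hdom hpt
    _ = K * (243 * (1 + ∫ z, z.1 i0 ^ 12 ∂μ + ∫ z, z.1 i1 ^ 12 ∂μ)) := by
        rw [integral_const_mul, integral_const_mul, integral_add ((integrable_const 1).fun_add (hI i0)) (hI i1),
          integral_add (integrable_const 1) (hI i0), integral_const, smul_eq_mul, mul_one, probReal_univ]
    _ ≤ K * (243 * (1 + 2 * C)) := by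
        have h2 : (1 : ℝ) + ∫ z, z.1 i0 ^ 12 ∂μ + ∫ z, z.1 i1 ^ 12 ∂μ ≤ 1 + 2 * C := by linarith [hC i0, hC i1]
        exact mul_le_mul_of_nonneg_left (mul_le_mul_of_nonneg_left h2 (by norm_num)) hK

end Gibbs

/-! ### The variance floor -/

/-- **Core of the variance floor** (general site labels `i0 = 0`, `i1 = 1` of an `n`-site chain, `n ≥ 2`): there is
`v₀ = v₀(ω₂, lam, β, T) > 0` with `Var_{μ_T}(Φ) ≥ v₀` for `Φ = ω₂ + 3 lam q_0² + 1 + 3β (q_1 - q_0)²`, uniformly in `n`.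
[folklore] -/
theorem varFloor_core {ω₂ lam β : ℝ} (hω : 0 < ω₂) (hl : 0 < lam) (hβ : 0 < β) (γ : ℝ) {T : ℝ} (hT : 0 < T) :
    ∃ v₀ : ℝ, 0 < v₀ ∧ ∀ (n : ℕ), 2 ≤ n → ∀ (i0 i1 : Fin n), i0.val = 0 → i1.val = 1 →
      ∀ Φ : PhaseSpace n → ℝ, (∀ z, Φ z = ω₂ + 3 * lam * z.1 i0 ^ 2 + 1 + 3 * β * (z.1 i1 - z.1 i0) ^ 2) →
        v₀ ≤ ∫ z, (Φ z - ∫ x, Φ x ∂((pinnedChain ω₂ lam β γ).gibbsMeasure n T)) ^ 2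
          ∂((pinnedChain ω₂ lam β γ).gibbsMeasure n T) := by
  obtain ⟨C₀, hC₀⟩ := gibbs_position_moment_le hω hl.le hβ.le γ hT 6
  set C : ℝ := max C₀ 0 with hCdef
  have hC0 : 0 ≤ C := le_max_right _ _
  have hC : ∀ (n : ℕ) (i : Fin n), ∫ x, x.1 i ^ 12 ∂((pinnedChain ω₂ lam β γ).gibbsMeasure n T) ≤ C := by
    intro n i
    have h := hC₀ n i
    norm_num at h
    exact h.trans (le_max_left _ _)
  -- the constants
  set M : ℝ := 243 * (1 + 2 * C) with hM
  set L₁ : ℝ := lam + 2 * β with hL₁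
  set L₂ : ℝ := ω₂ + lam + 2 + 4 * β with hL₂
  set L₃ : ℝ := ω₂ + 1 + 3 * lam + 6 * β with hL₃
  set A : ℝ := L₂ * L₂ * M with hA
  set B : ℝ := (L₁ * L₂) * (L₁ * L₂) * M with hB
  have hL₁0 : 0 < L₁ := by positivity
  have hL₂0 : 0 < L₂ := by positivity
  have hL₃0 : 0 < L₃ := by positivity
  have hA0 : 0 < A := by positivity
  have hB0 : 0 < B := by positivity
  set I₀ : ℝ := T ^ 2 * (lam + β) ^ 2 / A with hI₀
  have hI₀0 : 0 < I₀ := by positivity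
  refine ⟨36 * T ^ 2 * I₀ ^ 2 / B, by positivity, fun n hn i0 i1 h0 h1 Φ hΦ => ?_⟩
  have h01 : i1 ≠ i0 := fun h => by have := congrArg Fin.val h; omega
  set μ := (pinnedChain ω₂ lam β γ).gibbsMeasure n T with hμ
  haveI : IsProbabilityMeasure μ := pinnedChain_isProbabilityMeasure_gibbsMeasure hω hl.le hβ.le γ n hT
  set m : ℝ := ∫ x, Φ x ∂μ with hm
  -- the observables `W = ∂_{q_0}H`, `ℓ = ∂_{q_0}Φ / 6`, `X = 1 + q_0² + q_1²`
  obtain ⟨W, hW⟩ : ∃ W : PhaseSpace n → ℝ, ∀ z, W z =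
      ω₂ * z.1 i0 + lam * z.1 i0 ^ 3 - ((z.1 i1 - z.1 i0) + β * (z.1 i1 - z.1 i0) ^ 3) := ⟨_, fun z => rfl⟩
  obtain ⟨ℓ, hℓ⟩ : ∃ ℓ : PhaseSpace n → ℝ, ∀ z, ℓ z = lam * z.1 i0 - β * (z.1 i1 - z.1 i0) := ⟨_, fun z => rfl⟩
  obtain ⟨X, hX⟩ : ∃ X : PhaseSpace n → ℝ, ∀ z, X z = 1 + z.1 i0 ^ 2 + z.1 i1 ^ 2 := ⟨_, fun z => rfl⟩
  have hWq : ∀ x, partialQ i0 ((pinnedChain ω₂ lam β γ).hamiltonian n) x = W x := fun x => by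
    rw [hW]; exact varFloor_partialQ_zero ω₂ lam β γ hn h0 h1 x
  -- pointwise bounds
  have hpt : ∀ z, 1 ≤ X z ∧ |ℓ z| ≤ L₁ * X z ∧ |W z| ≤ L₂ * X z ^ 2 ∧ 0 ≤ Φ z ∧ Φ z ≤ L₃ * X z := by
    intro z
    rw [hX, hℓ, hW, hΦ]
    exact varFloor_poly_bounds hω.le hl.le hβ.le (z.1 i0) (z.1 i1)
  have hX0 : ∀ z, 0 ≤ X z := fun z => zero_le_one.trans (hpt z).1
  have prod : ∀ z (K₁ K₂ : ℝ) (j k : ℕ) (t₁ t₂ : ℝ), 0 ≤ K₁ → |t₁| ≤ K₁ * X z ^ j → |t₂| ≤ K₂ * X z ^ k →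
      |t₁ * t₂| ≤ K₁ * K₂ * X z ^ (j + k) := by
    intro z K₁ K₂ j k t₁ t₂ hK₁ ht₁ ht₂
    rw [abs_mul, pow_add, show K₁ * K₂ * (X z ^ j * X z ^ k) = (K₁ * X z ^ j) * (K₂ * X z ^ k) by ring]
    exact mul_le_mul ht₁ ht₂ (abs_nonneg _) (mul_nonneg hK₁ (pow_nonneg (hX0 z) j))
  have bℓ : ∀ z, |ℓ z| ≤ L₁ * X z ^ 1 := fun z => by rw [pow_one]; exact (hpt z).2.1
  have bW : ∀ z, |W z| ≤ L₂ * X z ^ 2 := fun z => (hpt z).2.2.1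
  have bΦ : ∀ z, |Φ z| ≤ L₃ * X z ^ 1 := fun z => by
    rw [pow_one, abs_of_nonneg (hpt z).2.2.2.1]; exact (hpt z).2.2.2.2
  have bℓW : ∀ z, |ℓ z * W z| ≤ L₁ * L₂ * X z ^ (1 + 2) := fun z => prod z L₁ L₂ 1 2 _ _ hL₁0.le (bℓ z) (bW z)
  have bΦℓ : ∀ z, |Φ z * ℓ z| ≤ L₃ * L₁ * X z ^ (1 + 1) := fun z => prod z L₃ L₁ 1 1 _ _ hL₃0.le (bΦ z) (bℓ z)
  have bΦℓW : ∀ z, |Φ z * ℓ z * W z| ≤ L₃ * L₁ * L₂ * X z ^ (1 + 1 + 2) := fun z =>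
    prod z (L₃ * L₁) L₂ (1 + 1) 2 _ _ (by positivity) (bΦℓ z) (bW z)
  have bℓ2 : ∀ z, |ℓ z ^ 2| ≤ L₁ * L₁ * X z ^ (1 + 1) := fun z => by
    rw [sq]; exact prod z L₁ L₁ 1 1 _ _ hL₁0.le (bℓ z) (bℓ z)
  have bW2 : ∀ z, |W z ^ 2| ≤ L₂ * L₂ * X z ^ (2 + 2) := fun z => by
    rw [sq]; exact prod z L₂ L₂ 2 2 _ _ hL₂0.le (bW z) (bW z)
  have bℓW2 : ∀ z, |(ℓ z * W z) ^ 2| ≤ (L₁ * L₂) * (L₁ * L₂) * X z ^ ((1 + 2) + (1 + 2)) := fun z => by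
    rw [sq]; exact prod z (L₁ * L₂) (L₁ * L₂) (1 + 2) (1 + 2) _ _ (by positivity) (bℓW z) (bℓW z)
  have bΦm2 : ∀ z, |(Φ z - m) ^ 2| ≤ (2 * L₃ ^ 2 + 2 * m ^ 2) * X z ^ 6 := by
    intro z
    obtain ⟨h1, -, -, hΦ0, hΦ'⟩ := hpt z
    rw [abs_of_nonneg (sq_nonneg _)]
    have hX6 : 1 ≤ X z ^ 6 := one_le_pow₀ h1
    have hX26 : X z ^ 2 ≤ X z ^ 6 := pow_le_pow_right₀ h1 (by norm_num)
    have hΦ2 : Φ z ^ 2 ≤ L₃ ^ 2 * X z ^ 2 := by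
      rw [← mul_pow]; exact pow_le_pow_left₀ hΦ0 hΦ' 2
    nlinarith [sq_nonneg (Φ z + m), mul_le_mul_of_nonneg_left hX26 (sq_nonneg L₃),
      mul_le_mul_of_nonneg_left hX6 (sq_nonneg m)]
  -- continuity
  have cΦ : Continuous Φ := by
    rw [show Φ = fun z => ω₂ + 3 * lam * z.1 i0 ^ 2 + 1 + 3 * β * (z.1 i1 - z.1 i0) ^ 2 from funext hΦ]; fun_prop
  have cW : Continuous W := by
    rw [show W = fun z : PhaseSpace n => ω₂ * z.1 i0 + lam * z.1 i0 ^ 3 -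
      ((z.1 i1 - z.1 i0) + β * (z.1 i1 - z.1 i0) ^ 3) from funext hW]; fun_prop
  have cℓ : Continuous ℓ := by
    rw [show ℓ = fun z : PhaseSpace n => lam * z.1 i0 - β * (z.1 i1 - z.1 i0) from funext hℓ]; fun_prop
  -- integrability under `μ` and `N`-uniform bounds, by domination with `K X⁶`
  have dom : ∀ {f : PhaseSpace n → ℝ}, Continuous f → ∀ {K : ℝ} (j : ℕ), 0 ≤ K → j ≤ 6 →
      (∀ z, |f z| ≤ K * X z ^ j) → Integrable f μ ∧ ∫ z, |f z| ∂μ ≤ K * M := by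
    intro f hf K j hK hj hle
    refine varFloor_dominated hω hl.le hβ.le γ hT i0 i1 hf hK (fun z => ?_) (hC n)
    rw [← hX]
    exact (hle z).trans (mul_le_mul_of_nonneg_left (pow_le_pow_right₀ (hpt z).1 hj) hK)
  have iℓ : Integrable ℓ μ := (dom cℓ 1 hL₁0.le (by norm_num) bℓ).1
  have iΦ : Integrable Φ μ := (dom cΦ 1 hL₃0.le (by norm_num) bΦ).1
  have iℓW : Integrable (fun z => ℓ z * W z) μ := (dom (cℓ.mul cW) _ (by positivity) (by norm_num) bℓW).1
  have iΦℓ : Integrable (fun z => Φ z * ℓ z) μ := (dom (cΦ.mul cℓ) _ (by positivity) (by norm_num) bΦℓ).1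
  have iΦℓW : Integrable (fun z => Φ z * ℓ z * W z) μ :=
    (dom ((cΦ.mul cℓ).mul cW) _ (by positivity) (by norm_num) bΦℓW).1
  have iℓ2 : Integrable (fun z => ℓ z ^ 2) μ := (dom (cℓ.pow 2) _ (by positivity) (by norm_num) bℓ2).1
  obtain ⟨iW2, hJ'⟩ := dom (cW.pow 2) _ (by positivity) (by norm_num) bW2
  obtain ⟨iℓW2, hG'⟩ := dom ((cℓ.mul cW).pow 2) _ (by positivity) (by norm_num) bℓW2
  have iΦm2 : Integrable (fun z => (Φ z - m) ^ 2) μ :=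
    (dom ((cΦ.sub continuous_const).pow 2) 6 (by positivity) le_rfl bΦm2).1
  have hJ : ∫ z, W z ^ 2 ∂μ ≤ A :=
    calc ∫ z, W z ^ 2 ∂μ = ∫ z, |W z ^ 2| ∂μ :=
          integral_congr_ae (Eventually.of_forall fun z => (abs_of_nonneg (sq_nonneg _)).symm)
      _ ≤ A := hJ'
  have hG : ∫ z, (ℓ z * W z) ^ 2 ∂μ ≤ B :=
    calc ∫ z, (ℓ z * W z) ^ 2 ∂μ = ∫ z, |(ℓ z * W z) ^ 2| ∂μ :=
          integral_congr_ae (Eventually.of_forall fun z => (abs_of_nonneg (sq_nonneg _)).symm)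
      _ ≤ B := hG'
  -- Gibbs integration by parts, 1: `∫ ℓ W dμ = T (lam + β)`
  have hd1 : ∀ x, HasLineDerivAt ℝ ℓ ((fun _ : PhaseSpace n => lam + β) x) x ((Pi.single i0 1, 0) : PhaseSpace n) := by
    intro x
    rw [show ℓ = fun z : PhaseSpace n => (fun a c : ℝ => lam * a - β * (c - a)) (z.1 i0) (z.1 i1) from funext hℓ]
    refine varFloor_hasLineDerivAt_of_hasDerivAt h01 (fun a c : ℝ => lam * a - β * (c - a)) x ?_
    have h1 : HasDerivAt (fun t : ℝ => x.1 i0 + t) 1 0 := (hasDerivAt_id' (0 : ℝ)).const_add _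
    have hr : HasDerivAt (fun t : ℝ => x.1 i1 - (x.1 i0 + t)) (-1) 0 := h1.const_sub _
    exact ((h1.const_mul lam).sub (hr.const_mul β)).congr_deriv (by ring)
  have e1 : ∫ z, ℓ z * W z ∂μ = T * (lam + β) := by
    have h : ∫ x, ℓ x * partialQ i0 ((pinnedChain ω₂ lam β γ).hamiltonian n) x ∂μ =
        T * ∫ x, (fun _ : PhaseSpace n => lam + β) x ∂μ :=
      varFloor_ibp hω hl.le hβ.le γ hT i0 hd1 (integrable_const _)
        (iℓW.congr (Eventually.of_forall fun x => by simp only [hWq])) iℓ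
    simp only [hWq, integral_const, smul_eq_mul, probReal_univ, one_mul] at h
    exact h
  -- Gibbs integration by parts, 2: `∫ Φ ℓ W dμ = 6 T ∫ ℓ² dμ + T (lam + β) ∫ Φ dμ`
  have hd2 : ∀ x, HasLineDerivAt ℝ (fun z => Φ z * ℓ z) ((fun z : PhaseSpace n => 6 * ℓ z ^ 2 + (lam + β) * Φ z) x) x
      ((Pi.single i0 1, 0) : PhaseSpace n) := by
    intro x
    rw [show (fun z => Φ z * ℓ z) = fun z : PhaseSpace n => (fun a c : ℝ => (ω₂ + 3 * lam * a ^ 2 + 1 + 3 * β * (c - a) ^ 2) *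
      (lam * a - β * (c - a))) (z.1 i0) (z.1 i1) from funext fun z => by simp only [hΦ, hℓ]]
    refine varFloor_hasLineDerivAt_of_hasDerivAt h01 (fun a c : ℝ => (ω₂ + 3 * lam * a ^ 2 + 1 + 3 * β * (c - a) ^ 2) *
      (lam * a - β * (c - a))) x ?_
    have h1 : HasDerivAt (fun t : ℝ => x.1 i0 + t) 1 0 := (hasDerivAt_id' (0 : ℝ)).const_add _
    have hr : HasDerivAt (fun t : ℝ => x.1 i1 - (x.1 i0 + t)) (-1) 0 := h1.const_sub _
    have hA' := ((((h1.pow 2).const_mul (3 * lam)).const_add ω₂).add_const 1).add ((hr.pow 2).const_mul (3 * β))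
    have hB' := (h1.const_mul lam).sub (hr.const_mul β)
    refine (hA'.mul hB').congr_deriv ?_
    simp only [hΦ, hℓ]
    norm_num
    ring
  have e2 : ∫ z, Φ z * ℓ z * W z ∂μ = 6 * T * ∫ z, ℓ z ^ 2 ∂μ + T * (lam + β) * m := by
    have h : ∫ x, (fun z => Φ z * ℓ z) x * partialQ i0 ((pinnedChain ω₂ lam β γ).hamiltonian n) x ∂μ =
        T * ∫ x, (fun z : PhaseSpace n => 6 * ℓ z ^ 2 + (lam + β) * Φ z) x ∂μ :=
      varFloor_ibp hω hl.le hβ.le γ hT i0 hd2 ((iℓ2.const_mul 6).add (iΦ.const_mul (lam + β)))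
        (iΦℓW.congr (Eventually.of_forall fun x => by simp only [hWq])) iΦℓ
    simp only [hWq] at h
    rw [h, integral_add (iℓ2.const_mul 6) (iΦ.const_mul (lam + β)), integral_const_mul, integral_const_mul]
    ring
  -- hence `∫ (Φ - m) ℓ W dμ = 6 T ∫ ℓ²`
  have e3 : ∫ z, (Φ z - m) * (ℓ z * W z) ∂μ = 6 * T * ∫ z, ℓ z ^ 2 ∂μ := by
    have e : (fun z => (Φ z - m) * (ℓ z * W z)) = fun z => Φ z * ℓ z * W z - m * (ℓ z * W z) := by
      funext z; ring
    rw [e, integral_sub iΦℓW (iℓW.const_mul m), integral_const_mul, e2, e1]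
    ring
  -- Cauchy–Schwarz, twice
  have cs1 : (∫ z, ℓ z * W z ∂μ) ^ 2 ≤ (∫ z, ℓ z ^ 2 ∂μ) * ∫ z, W z ^ 2 ∂μ :=
    lightCone_integral_mul_sq_le cℓ.aestronglyMeasurable cW.aestronglyMeasurable iℓ2 iW2
  have cs2 : (∫ z, (Φ z - m) * (ℓ z * W z) ∂μ) ^ 2 ≤ (∫ z, (Φ z - m) ^ 2 ∂μ) * ∫ z, (ℓ z * W z) ^ 2 ∂μ :=
    lightCone_integral_mul_sq_le (cΦ.sub continuous_const).aestronglyMeasurable (cℓ.mul cW).aestronglyMeasurable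
      iΦm2 iℓW2
  -- assembling
  have hIℓ0 : 0 ≤ ∫ z, ℓ z ^ 2 ∂μ := integral_nonneg fun z => sq_nonneg _
  have hV0 : 0 ≤ ∫ z, (Φ z - m) ^ 2 ∂μ := integral_nonneg fun z => sq_nonneg _
  have step1 : T ^ 2 * (lam + β) ^ 2 ≤ (∫ z, ℓ z ^ 2 ∂μ) * A :=
    calc T ^ 2 * (lam + β) ^ 2 = (∫ z, ℓ z * W z ∂μ) ^ 2 := by rw [e1]; ring
      _ ≤ (∫ z, ℓ z ^ 2 ∂μ) * ∫ z, W z ^ 2 ∂μ := cs1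
      _ ≤ (∫ z, ℓ z ^ 2 ∂μ) * A := mul_le_mul_of_nonneg_left hJ hIℓ0
  have step2 : I₀ ≤ ∫ z, ℓ z ^ 2 ∂μ := by rw [hI₀, div_le_iff₀ hA0]; exact step1
  have step3 : 36 * T ^ 2 * (∫ z, ℓ z ^ 2 ∂μ) ^ 2 ≤ (∫ z, (Φ z - m) ^ 2 ∂μ) * B :=
    calc 36 * T ^ 2 * (∫ z, ℓ z ^ 2 ∂μ) ^ 2 = (∫ z, (Φ z - m) * (ℓ z * W z) ∂μ) ^ 2 := by rw [e3]; ring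
      _ ≤ (∫ z, (Φ z - m) ^ 2 ∂μ) * ∫ z, (ℓ z * W z) ^ 2 ∂μ := cs2
      _ ≤ (∫ z, (Φ z - m) ^ 2 ∂μ) * B := mul_le_mul_of_nonneg_left hG hV0
  have step4 : 36 * T ^ 2 * I₀ ^ 2 ≤ (∫ z, (Φ z - m) ^ 2 ∂μ) * B :=
    (mul_le_mul_of_nonneg_left (pow_le_pow_left₀ hI₀0.le step2 2) (by positivity)).trans step3
  rw [div_le_iff₀ hB0]
  exact step4

/-- SUB-GOAL K5 (`N`-uniform non-degeneracy of the local curvature): `Var_{μ_N}(Φ) ≥ v₀ > 0` for all `N ≥ 2`, where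
`Φ = ∂²_{q_0}H = ω₂ + 3 lam q_0² + 1 + 3β(q_1 - q_0)²` and `μ_N` is the Gibbs measure of the `(N+1)`-site chain at
temperature `T` (Cramér–Rao via Gibbs integration by parts in `q_0`, twice; `N`-uniform moments). [folklore] -/
theorem sa_varianceFloor :
    ∀ ω₂ lam β γ : ℝ, 0 < ω₂ → 0 < lam → 0 < β → 0 < γ → ∀ T : ℝ, 0 < T → ∃ v₀ : ℝ, 0 < v₀ ∧ ∀ (N : ℕ) (hN : 2 ≤ N), v₀ ≤ ∫ z, ((ω₂ + 3 * lam * z.1 0 ^ 2 + 1 + 3 * β * (z.1 ⟨1, by omega⟩ - z.1 0) ^ 2) - ∫ x, (ω₂ + 3 * lam * x.1 0 ^ 2 + 1 + 3 * β * (x.1 ⟨1, by omega⟩ - x.1 0) ^ 2) ∂((pinnedChain ω₂ lam β γ).gibbsMeasure (N + 1) T)) ^ 2 ∂((pinnedChain ω₂ lam β γ).gibbsMeasure (N + 1) T) := by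
  intro ω₂ lam β γ hω hl hβ _hγ T hT
  obtain ⟨v₀, hv₀, h⟩ := varFloor_core hω hl hβ γ hT
  exact ⟨v₀, hv₀, fun N hN => h (N + 1) (by omega) 0 ⟨1, by omega⟩ (by simp) rfl _ fun z => rfl⟩

end Summit.AtomisticToContinuum.FouriersLaw.Theorems.CoherentDephasing.StrictAbsorption

end
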